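import Summits.CriticalPhenomena.CardyFormulaZ2.Theorems.CardyComplexConeEdgePrecompactUFRSTwoArcSurround

set_option linter.unusedVariables false

/-!
# Two orbit stretches: the last bad common time and the confinement principle
(line `qkz-strip-boundary-arm` of crux `CardyComplexCone.EdgePrecompact`, stmt-CriticalPhenomena-11387;
planar core of the strand extraction of the residual `ufrs_slippedReturnCase_cert(J)`, ball-exit pair)

Two stretches `O₀ [0, n₀]`, `O₁ [0, n₁]` with the same first and last corner and per-dart integer
weights `a`, `b` (in the application: the winding contributions `dartWnd` of the coded darts at a
face `F` next to the first dart, which have different totals `Δ = ∑ a - ∑ b ≠ 0` by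
`twoArc_dartWnd_ne_SR`). The OFFSET at a common time `j` (`O₁ j = O₀ i`) is `∑_{i'<i} a - ∑_{j'<j} b`.

* `exists_lastBad_common_SR` — the LAST common time `s` (`O₁ s = O₀ σ`) whose offset is not `Δ`:
  it exists (`offset 0 = 0`), and every later common time has offset `Δ`. (The excursion of the
  second stretch starting at `s` is the last one with nonzero winding weight.)
* `dwnd_eq_zero_of_confined_SR` — CONFINEMENT: a closed chain of unit-or-null steps all of whose
  tails, in the plane picture `psiC δ`, lie within `R` of a point `z` at distance `≥ 2R` from the
  centre of the face `F` has winding number `0` around `F` (by the quadrant lemma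
  `closedChain_quadrants_SR`: a vertex in each closed quadrant at `F` would put the centre of `F`
  within `2R` of `z`).
* `twoArc_offset_eq_of_confined_SR` (registered anchor) — hence the offsets at two common times
  `s ≤ j` (`P₁ s = P₀ σ`, `P₁ j = P₀ i`) of two unit-step sequences COINCIDE as soon as the piece of
  the first sequence between `σ` and `i` and the piece of the second between `s` and `j` stay within
  `R` of such a point `z`: the closed chain "first sequence from `σ` to `i`, second sequence back
  from `j` to `s`" has winding `offset j - offset s`.

In the residual these give: the split corner `X` of the last bad common time carries three long
corner-disjoint strands (the two halves of the first stretch at `X` and the second stretch after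
the split), because a return of the second stretch to the first one near `X` would be a later
common time with a different offset, contradicting confinement.

References: H. Hopf, Compositio Math. 2 (1935), Satz I; S. Smirnov, C. R. Acad. Sci. Paris 333 (2001), §2.
-/

namespace Summit.CriticalPhenomena.CardyFormulaZ2.Cruxes.EdgePrecompact.QkzStripBoundaryArm

open MeasureTheory Filter Set Metric
open scoped Topology BigOperators Pointwise
open Literature.Probability.LatticeModels Literature.Probability.Percolation
open Literature.Probability.LatticeModels.MedialTrail

noncomputable section

/-! ## The last bad common time -/

/-- **The last bad common time.** Two sequences with `O₁ 0 = O₀ 0` and weights with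
`Δ := ∑_{i<n₀} a - ∑_{j<n₁} b ≠ 0`: there is a common time `s ≤ n₁` (`O₁ s = O₀ σ`, `σ ≤ n₀`) with
offset `∑_{i<σ} a - ∑_{j<s} b ≠ Δ` such that every LATER common time `j ≤ n₁` (`O₁ j = O₀ i`,
`i ≤ n₀`) has offset `Δ`. -/
theorem exists_lastBad_common_SR {X : Type*} (O₀ O₁ : ℕ → X) (n₀ n₁ : ℕ) (a b : ℕ → ℤ)
    (h0 : O₁ 0 = O₀ 0) (hne : ∑ i ∈ Finset.range n₀, a i ≠ ∑ j ∈ Finset.range n₁, b j) :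
    ∃ s σ : ℕ, s ≤ n₁ ∧ σ ≤ n₀ ∧ O₁ s = O₀ σ ∧
      (∑ i ∈ Finset.range σ, a i - ∑ j ∈ Finset.range s, b j ≠
        ∑ i ∈ Finset.range n₀, a i - ∑ j ∈ Finset.range n₁, b j) ∧
      (∀ j i : ℕ, s < j → j ≤ n₁ → i ≤ n₀ → O₁ j = O₀ i →
        ∑ i' ∈ Finset.range i, a i' - ∑ j' ∈ Finset.range j, b j' =
          ∑ i ∈ Finset.range n₀, a i - ∑ j ∈ Finset.range n₁, b j) := by
  classical
  set Δ := ∑ i ∈ Finset.range n₀, a i - ∑ j ∈ Finset.range n₁, b j with hΔ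
  set Bad : ℕ → Prop := fun j => ∃ i ≤ n₀, O₁ j = O₀ i ∧
    ∑ i' ∈ Finset.range i, a i' - ∑ j' ∈ Finset.range j, b j' ≠ Δ with hBad
  have hΔ0 : Δ ≠ 0 := sub_ne_zero.2 hne
  have hBad0 : Bad 0 := ⟨0, Nat.zero_le _, h0, by simpa using hΔ0.symm⟩
  obtain ⟨σ, hσ, hsσ, hoff⟩ : Bad (Nat.findGreatest Bad n₁) :=
    Nat.findGreatest_spec (P := Bad) (Nat.zero_le n₁) hBad0
  refine ⟨Nat.findGreatest Bad n₁, σ, Nat.findGreatest_le _, hσ, hsσ, hoff, fun j i hj hjn hi hji => ?_⟩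
  by_contra hne'
  exact Nat.findGreatest_is_greatest hj hjn ⟨i, hi, hji, hne'⟩

/-! ## Confinement: closed chains away from a face do not wind around it -/

/-- **Confinement principle.** A closed chain of unit-or-null steps whose tails `psiC δ d.1` all lie
within `R` of a point `z` with `2R ≤ dist (faceCentreC δ F) z` has `dwnd D F = 0`. -/
theorem dwnd_eq_zero_of_confined_SR {δ : ℝ} (hδ : 0 < δ) (D : List (Pt × Pt)) (F : Pt) (z : ℂ) (R : ℝ)
    (hD : ∀ d ∈ D, IsUnitStep d.1 d.2 ∨ d.1 = d.2)
    (hK : ∀ g : Pt → ℤ, (D.map fun d => g d.2 - g d.1).sum = 0)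
    (hconf : ∀ d ∈ D, dist (psiC δ d.1) z < R)
    (hfar : 2 * R ≤ dist (faceCentreC δ F) z) : dwnd D F = 0 := by
  by_contra hw
  obtain ⟨⟨d₁, hd₁, q₁⟩, ⟨d₂, hd₂, q₂⟩, ⟨d₃, hd₃, q₃⟩, ⟨d₄, hd₄, q₄⟩⟩ := closedChain_quadrants_SR D F hD hK hw
  have hre : ∀ p : Pt, (psiC δ p).re = δ / 2 * ((p.1 : ℝ) - p.2 + 1) := fun p => by
    rw [psiC_re]; push_cast; ring
  have him : ∀ p : Pt, (psiC δ p).im = δ / 2 * ((p.1 : ℝ) + p.2) := fun p => by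
    rw [psiC_im]; push_cast; ring
  have fre : (faceCentreC δ F).re = δ / 2 * ((F.1 : ℝ) - F.2 + 1) := by
    simp [faceCentreC]
  have fim : (faceCentreC δ F).im = δ / 2 * ((F.1 : ℝ) + F.2 + 1) := by
    simp [faceCentreC]
  have key : ∀ d ∈ D, |(psiC δ d.1).re - z.re| < R ∧ |(psiC δ d.1).im - z.im| < R := by
    intro d hd
    have h := hconf d hd
    rw [dist_eq_norm] at h
    refine ⟨lt_of_le_of_lt ?_ h, lt_of_le_of_lt ?_ h⟩
    · rw [← Complex.sub_re]; exact Complex.abs_re_le_norm _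
    · rw [← Complex.sub_im]; exact Complex.abs_im_le_norm _
  have hδ2 : 0 < δ / 2 := by positivity
  -- the four tails pin the face centre coordinatewise
  have k₁ := (abs_lt.1 (key d₁ hd₁).2).2
  have k₂ := (abs_lt.1 (key d₂ hd₂).1).1
  have k₃ := (abs_lt.1 (key d₃ hd₃).2).1
  have k₄ := (abs_lt.1 (key d₄ hd₄).1).2
  rw [him] at k₁ k₃
  rw [hre] at k₂ k₄
  have c₁ : ((F.1 : ℝ) + F.2 + 1) + 1 ≤ (d₁.1.1 : ℝ) + d₁.1.2 := by exact_mod_cast (by omega : F.1 + F.2 + 1 + 1 ≤ d₁.1.1 + d₁.1.2)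
  have c₃ : (d₃.1.1 : ℝ) + d₃.1.2 ≤ (F.1 : ℝ) + F.2 := by exact_mod_cast (by omega : d₃.1.1 + d₃.1.2 ≤ F.1 + F.2)
  have c₂ : (d₂.1.1 : ℝ) - d₂.1.2 + 1 ≤ ((F.1 : ℝ) - F.2 + 1) - 1 := by exact_mod_cast (by omega : d₂.1.1 - d₂.1.2 + 1 ≤ F.1 - F.2 + 1 - 1)
  have c₄ : ((F.1 : ℝ) - F.2 + 1) + 1 ≤ (d₄.1.1 : ℝ) - d₄.1.2 + 1 := by exact_mod_cast (by omega : F.1 - F.2 + 1 + 1 ≤ d₄.1.1 - d₄.1.2 + 1)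
  have i_up : (faceCentreC δ F).im - z.im < R := by
    rw [fim]; nlinarith [mul_le_mul_of_nonneg_left c₁ hδ2.le]
  have i_dn : -R < (faceCentreC δ F).im - z.im := by
    rw [fim]; nlinarith [mul_le_mul_of_nonneg_left c₃ hδ2.le]
  have r_up : (faceCentreC δ F).re - z.re < R := by
    rw [fre]; nlinarith [mul_le_mul_of_nonneg_left c₄ hδ2.le]
  have r_dn : -R < (faceCentreC δ F).re - z.re := by
    rw [fre]; nlinarith [mul_le_mul_of_nonneg_left c₂ hδ2.le]
  have hn := Complex.norm_le_abs_re_add_abs_im (faceCentreC δ F - z)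
  rw [Complex.sub_re, Complex.sub_im, ← dist_eq_norm] at hn
  have h1 : |(faceCentreC δ F).re - z.re| < R := abs_lt.2 ⟨r_dn, r_up⟩
  have h2 : |(faceCentreC δ F).im - z.im| < R := abs_lt.2 ⟨i_dn, i_up⟩
  linarith

/-! ## Offsets at confined common times coincide -/

/-- **Offsets at confined common times coincide** (registered anchor). DATA: two sequences of
unit steps `P₀`, `P₁` in the medial lattice; common times `s ≤ j` of the second with positions
`P₁ s = P₀ σ`, `P₁ j = P₀ i` on the first; a face `F`, a mesh `δ > 0`, a point `z` and a radius `R`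
with `2R ≤ dist (faceCentreC δ F) z`; every `psiC δ (P₀ m)` for `m` between `σ` and `i` and every
`psiC δ (P₁ m)` for `s < m ≤ j` within `R` of `z`. CONCLUSION:
`∑_{m<i} a - ∑_{m<σ} a = ∑_{m<j} b - ∑_{m<s} b` for the weights `a m = dartWnd (P₀ m, P₀ (m+1)) F`,
`b m = dartWnd (P₁ m, P₁ (m+1)) F`. -/
theorem twoArc_offset_eq_of_confined_SR : ∀ (P₀ P₁ : ℕ → MedialTrail.Pt) (F : MedialTrail.Pt) (δ : ℝ) (z : ℂ) (R : ℝ) (s j σ i : ℕ), 0 < δ → (∀ m, MedialTrail.IsUnitStep (P₀ m) (P₀ (m + 1))) → (∀ m, MedialTrail.IsUnitStep (P₁ m) (P₁ (m + 1))) → s ≤ j → P₁ s = P₀ σ → P₁ j = P₀ i → (∀ m, σ ≤ m → m ≤ i → dist (psiC δ (P₀ m)) z < R) → (∀ m, i ≤ m → m ≤ σ → dist (psiC δ (P₀ m)) z < R) → (∀ m, s < m → m ≤ j → dist (psiC δ (P₁ m)) z < R) → 2 * R ≤ dist (faceCentreC δ F) z → ∑ m ∈ Finset.range i, MedialTrail.dartWnd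 (P₀ m, P₀ (m + 1)) F - ∑ m ∈ Finset.range σ, MedialTrail.dartWnd (P₀ m, P₀ (m + 1)) F = ∑ m ∈ Finset.range j, MedialTrail.dartWnd (P₁ m, P₁ (m + 1)) F - ∑ m ∈ Finset.range s, MedialTrail.dartWnd (P₁ m, P₁ (m + 1)) F := by
  intro P₀ P₁ F δ z R s j σ i hδ hu₀ hu₁ hsj hs hj hconf₀ hconf₀' hconf₁ hfar
  set a : ℕ → ℤ := fun m => dartWnd (P₀ m, P₀ (m + 1)) F with ha
  set b : ℕ → ℤ := fun m => dartWnd (P₁ m, P₁ (m + 1)) F with hb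
  have e2 := sum_range_sub_sum_range_SR b s (j - s)
  rw [show s + (j - s) = j by omega] at e2
  have e4 : ∑ k ∈ Finset.range (j - s), b (s + k) = ∑ k ∈ Finset.range (j - s), dartWnd (P₁ (s + k), P₁ (s + k + 1)) F := rfl
  have hB : ∀ d ∈ bwdPiece P₁ s (j - s), dist (psiC δ d.1) z < R := by
    intro d hd
    obtain ⟨k, hk, rfl⟩ := mem_bwdPiece_SR hd
    exact hconf₁ (s + k + 1) (by omega) (by omega)
  rcases le_or_gt σ i with hσi | hiσ
  · -- first sequence forward from `σ` to `i`, second sequence backward from `j` to `s`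
    set Γ : List (Pt × Pt) := fwdPiece P₀ σ (i - σ) ++ bwdPiece P₁ s (j - s) with hΓ
    have hΓu : ∀ d ∈ Γ, IsUnitStep d.1 d.2 ∨ d.1 = d.2 := by
      intro d hd
      rw [hΓ, List.mem_append] at hd
      rcases hd with hd | hd
      · obtain ⟨k, hk, rfl⟩ := mem_fwdPiece_SR hd; exact Or.inl (hu₀ _)
      · obtain ⟨k, hk, rfl⟩ := mem_bwdPiece_SR hd; exact Or.inl (hu₁ _).symm
    have hΓK : ∀ g : Pt → ℤ, (Γ.map fun d => g d.2 - g d.1).sum = 0 := by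
      intro g
      rw [hΓ, List.map_append, List.sum_append, fwdPiece_boundary_SR, bwdPiece_boundary_SR,
        show σ + (i - σ) = i by omega, show s + (j - s) = j by omega, hs, hj]
      ring
    have hΓc : ∀ d ∈ Γ, dist (psiC δ d.1) z < R := by
      intro d hd
      rw [hΓ, List.mem_append] at hd
      rcases hd with hd | hd
      · obtain ⟨k, hk, rfl⟩ := mem_fwdPiece_SR hd
        exact hconf₀ (σ + k) (by omega) (by omega)
      · exact hB d hd
    have h0 := dwnd_eq_zero_of_confined_SR hδ Γ F z R hΓu hΓK hΓc hfar
    rw [hΓ, dwnd_append, dwnd_fwdPiece_SR, dwnd_bwdPiece_SR _ _ _ _ (fun k _ => hu₁ _)] at h0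
    have e1 := sum_range_sub_sum_range_SR a σ (i - σ)
    rw [show σ + (i - σ) = i by omega] at e1
    have e3 : ∑ k ∈ Finset.range (i - σ), a (σ + k) = ∑ k ∈ Finset.range (i - σ), dartWnd (P₀ (σ + k), P₀ (σ + k + 1)) F := rfl
    change ∑ m ∈ Finset.range i, a m - ∑ m ∈ Finset.range σ, a m = ∑ m ∈ Finset.range j, b m - ∑ m ∈ Finset.range s, b m
    linarith
  · -- first sequence backward from `σ` to `i`, second sequence backward from `j` to `s`
    set Γ : List (Pt × Pt) := bwdPiece P₀ i (σ - i) ++ bwdPiece P₁ s (j - s) with hΓ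
    have hΓu : ∀ d ∈ Γ, IsUnitStep d.1 d.2 ∨ d.1 = d.2 := by
      intro d hd
      rw [hΓ, List.mem_append] at hd
      rcases hd with hd | hd
      · obtain ⟨k, hk, rfl⟩ := mem_bwdPiece_SR hd; exact Or.inl (hu₀ _).symm
      · obtain ⟨k, hk, rfl⟩ := mem_bwdPiece_SR hd; exact Or.inl (hu₁ _).symm
    have hΓK : ∀ g : Pt → ℤ, (Γ.map fun d => g d.2 - g d.1).sum = 0 := by
      intro g
      rw [hΓ, List.map_append, List.sum_append, bwdPiece_boundary_SR, bwdPiece_boundary_SR,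
        show i + (σ - i) = σ by omega, show s + (j - s) = j by omega, hs, hj]
      ring
    have hΓc : ∀ d ∈ Γ, dist (psiC δ d.1) z < R := by
      intro d hd
      rw [hΓ, List.mem_append] at hd
      rcases hd with hd | hd
      · obtain ⟨k, hk, rfl⟩ := mem_bwdPiece_SR hd
        exact hconf₀' (i + k + 1) (by omega) (by omega)
      · exact hB d hd
    have h0 := dwnd_eq_zero_of_confined_SR hδ Γ F z R hΓu hΓK hΓc hfar
    rw [hΓ, dwnd_append, dwnd_bwdPiece_SR _ _ _ _ (fun k _ => hu₀ _), dwnd_bwdPiece_SR _ _ _ _ (fun k _ => hu₁ _)] at h0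
    have e1 := sum_range_sub_sum_range_SR a i (σ - i)
    rw [show i + (σ - i) = σ by omega] at e1
    have e3 : ∑ k ∈ Finset.range (σ - i), a (i + k) = ∑ k ∈ Finset.range (σ - i), dartWnd (P₀ (i + k), P₀ (i + k + 1)) F := rfl
    change ∑ m ∈ Finset.range i, a m - ∑ m ∈ Finset.range σ, a m = ∑ m ∈ Finset.range j, b m - ∑ m ∈ Finset.range s, b m
    linarith

end

end Summit.CriticalPhenomena.CardyFormulaZ2.Cruxes.EdgePrecompact.QkzStripBoundaryArm
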